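import Summits.HodgeConjecture.HodgeConjecture.Theses.SaitoKurokawaBridge

/-!
# Route `SaitoKurokawaBridge`: the `Assembly` (item `stmt-HodgeConjecture-3278`)

Pure logic. The assembly item of route `HodgeConjecture/SaitoKurokawaBridge` states

  `ExtremeBridgeFailure → ¬ HodgeConjecture`.

Proof: from a witness `(n, Y, X, hY, hX, κ, a, b, …)` of `ExtremeBridgeFailure` apply
`HodgeConjecture` at `Y ⊗ X`, which is smooth projective of dimension `n + n` by
`Literature.AlgebraicGeometry.Motives.IsSmoothProjective.tensor_holds hY hX`; the cycle conjunct of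
`HodgeConjectureFor (n + n) (Y ⊗ X)` at `p = n` puts the rational `(n,n)`-class `κ` in
`algebraicClasses (Y ⊗ X) n`, and the witness's last clause then gives `κ ∪ fst*a ∪ snd*b = 0`,
contradicting `≠ 0`. This is the same term as the route's deciding theorem `closes`, recorded
against the item's own decl `Assembly`.

No named facts are used; the theorem is unconditional.
-/

-- `Summit.HodgeConjecture.HodgeConjecture.Theorems` is the mandated namespace (single-conjunct summit:
-- Sub = Summit), which `linter.dupNamespace` flags on every declaration; the lakefile turns the
-- linter off tree-wide (weak option), restated here so stand-alone elaboration is warning-free too.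
set_option linter.dupNamespace false

namespace Summit.HodgeConjecture.HodgeConjecture.Theorems

/-- **Assembly of route `SaitoKurokawaBridge`** (item `stmt-HodgeConjecture-3278`): an extreme-type
bridge failure refutes the Hodge conjecture, `ExtremeBridgeFailure → ¬ HodgeConjecture`. From a
witness `(n, Y, X, hY, hX, κ, a, b, …)` apply `HodgeConjecture` at `Y ⊗ X` (smooth projective of
dimension `n + n` by `IsSmoothProjective.tensor_holds hY hX`); its cycle conjunct at `p = n` puts the
rational `(n,n)`-class `κ` in `algebraicClasses (Y ⊗ X) n`, and the witness's last clause gives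
`κ ∪ fst*a ∪ snd*b = 0`, contradicting `≠ 0`. The type is literally the route decl
`Summit.HodgeConjecture.HodgeConjecture.Theses.SaitoKurokawaBridge.Assembly`. -/
theorem saitoKurokawaBridge_assembly_proof :
    Summit.HodgeConjecture.HodgeConjecture.Theses.SaitoKurokawaBridge.Assembly := by
  unfold Summit.HodgeConjecture.HodgeConjecture.Theses.SaitoKurokawaBridge.Assembly
  intro hX hHC
  obtain ⟨n, Y, X, hY, hXs, κ, a, b, hrat, hκ, _ha, _hb, hne, hall⟩ := hX
  have hYX : Literature.AlgebraicGeometry.Motives.IsSmoothProjective (n + n)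
      (CategoryTheory.MonoidalCategoryStruct.tensorObj Y X) :=
    Literature.AlgebraicGeometry.Motives.IsSmoothProjective.tensor_holds hY hXs
  exact hne (hall κ ((hHC hYX).2 n κ hrat hκ))

end Summit.HodgeConjecture.HodgeConjecture.Theorems
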